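import Summits.AtomisticToContinuum.HydrodynamicLimit.Theorems.CollisionIsometryCLTAdaptedWeightCLTTimeLocal
import Literature.Analysis.FluidPDE.HardSphereTorusMeasure
import Literature.Analysis.FluidPDE.ConfinedHardSphereFlowShortBad

/-!
# Stub `stub_pastDamping` of the line `contact-source-duhamel` — helper file: the HARD-CORE DENSITY
CAP (crux `CollisionIsometryCLT.AdaptedWeightCLT`, stmt-AtomisticToContinuum-14868, `--supports`)

The one deterministic a-priori bound the PAST estimate uses on the block fields: on the hard-sphere
domain the block density `ρ̄(s, x) = (N+1)⁻¹ Σ_i φ_N(x_i(s) − x)` of an admissible kernel family is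
bounded UNIFORMLY in `N`, `x` and the configuration,
  `Σ_i φ_N(x_i − x) ≤ ‖φ_N‖_∞ · #{i : dist(x_i, x) < (N+1)^{-γ}} ≤ C (N+1)^{3γ} (2(N+1)^{-γ}/ε_N + 1)³`,
because at most `(2R/ε + 1)³` centres at mutual minimal-image distance `≥ ε` fit in a ball of radius
`R` (`card_filter_near_le`: the balls of radius `ε/2` about them are disjoint and lie in the ball of
radius `R + ε/2`; Haar volumes of small balls on `𝕋³` are Euclidean, `Torus.volume_euclidDist_lt`).
With `ε_N = σ (N+1)^{-1/3}` this is `(N+1) ρ̄ ≤ 64 C (N+1)/σ³`-type uniformity (`sum_kernel_le`,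
`sum_wgt_le`): the planner's "hard-core density cap `sup_x ρ̄ ≤ 8C/σ³`" up to the constant.
-/

namespace Summit.AtomisticToContinuum.HydrodynamicLimit.Theorems.ContactSourceDuhamel.TimeLocal
namespace PastDamping

open scoped BigOperators Topology Classical MeasureTheory ENNReal InnerProductSpace
open Filter Set MeasureTheory Metric
open Literature.Analysis.FluidPDE Literature.Analysis.FluidPDE.Torus

noncomputable section

/-! ## Packing on the torus -/

/-- Minimal-image balls are measurable. -/
theorem measurableSet_euclidDist_lt (c : T3) (r : ℝ) : MeasurableSet {x : T3 | euclidDist x c < r} :=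
  measurableSet_lt (continuous_euclidDist.comp (continuous_id.prodMk continuous_const)).measurable
    measurable_const

/-- The shifted minimal-image distance to the origin is the distance: `d(a − b, 0) = d(a, b)`. -/
theorem euclidDist_sub_zero (a b : T3) : euclidDist (a - b) 0 = euclidDist a b := by
  rw [euclidDist_eq, euclidDist_eq, sub_zero]

/-- The Haar volume of a small minimal-image ball scales like the cube of the radius. -/
theorem volume_euclidDist_lt_eq (c : T3) {r : ℝ} (hr : 0 < r) (hr' : r < 1 / 2) :
    volume {x : T3 | euclidDist x c < r} =
      ENNReal.ofReal (r ^ 3) * volume (ball (0 : V3) 1) := by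
  rw [volume_euclidDist_lt hr' c, Measure.addHaar_ball_of_pos _ _ hr, finrank_euclideanSpace_fin]

/-- **Packing on `𝕋³`.** Among points at mutual minimal-image distance `≥ ε`, at most
`(2R/ε + 1)³` lie within distance `< R` of any given point (for `R + ε/2 < 1/2`). -/
theorem card_filter_near_le {ι : Type*} (s : Finset ι) (p : ι → T3) (x : T3) {ε R : ℝ}
    (hε : 0 < ε) (hR : 0 ≤ R) (hhalf : R + ε / 2 < 1 / 2)
    (hsep : ∀ i ∈ s, ∀ j ∈ s, i ≠ j → ε ≤ euclidDist (p i) (p j)) :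
    ((s.filter fun i => euclidDist (p i) x < R).card : ℝ) ≤ (2 * R / ε + 1) ^ 3 := by
  set A := s.filter fun i => euclidDist (p i) x < R with hA
  set U : ι → Set T3 := fun i => {y | euclidDist y (p i) < ε / 2} with hU
  set W : Set T3 := {y | euclidDist y x < R + ε / 2} with hW
  have hε2 : 0 < ε / 2 := by linarith
  have hε2' : ε / 2 < 1 / 2 := by linarith
  have hRε : 0 < R + ε / 2 := by linarith
  -- the small balls are pairwise disjoint
  have hdisj : Set.PairwiseDisjoint (↑A : Set ι) U := by
    intro i hi j hj hij
    refine Set.disjoint_left.2 fun y hyi hyj => ?_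
    have hi' : i ∈ s := (Finset.mem_filter.1 hi).1
    have hj' : j ∈ s := (Finset.mem_filter.1 hj).1
    have h1 : euclidDist y (p i) < ε / 2 := hyi
    have h2 : euclidDist y (p j) < ε / 2 := hyj
    have htri := euclidDist_triangle (p i) y (p j)
    rw [euclidDist_comm (p i) y] at htri
    have := hsep i hi' j hj' hij
    linarith
  -- and contained in the big ball
  have hsub : ∀ i ∈ A, U i ⊆ W := by
    intro i hi y hy
    have hi' : euclidDist (p i) x < R := (Finset.mem_filter.1 hi).2
    have hy' : euclidDist y (p i) < ε / 2 := hy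
    have htri := euclidDist_triangle y (p i) x
    show euclidDist y x < R + ε / 2
    linarith
  have hvol : ∑ i ∈ A, volume (U i) ≤ volume W := by
    rw [← measure_biUnion_finset hdisj fun i _ => measurableSet_euclidDist_lt (p i) (ε / 2)]
    exact measure_mono (Set.iUnion₂_subset hsub)
  have hUvol : ∀ i ∈ A, volume (U i) = ENNReal.ofReal ((ε / 2) ^ 3) * volume (ball (0 : V3) 1) :=
    fun i _ => volume_euclidDist_lt_eq (p i) hε2 hε2'
  rw [Finset.sum_congr rfl hUvol, Finset.sum_const, nsmul_eq_mul, hW,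
    volume_euclidDist_lt_eq x hRε hhalf] at hvol
  -- cancel the volume of the unit ball
  have hv0 : volume (ball (0 : V3) 1) ≠ 0 := (measure_ball_pos volume (0 : V3) one_pos).ne'
  have hvtop : volume (ball (0 : V3) 1) ≠ ∞ := measure_ball_lt_top.ne
  rw [← mul_assoc] at hvol
  have h2 : (A.card : ℝ≥0∞) * ENNReal.ofReal ((ε / 2) ^ 3) ≤ ENNReal.ofReal ((R + ε / 2) ^ 3) :=
    (ENNReal.mul_le_mul_iff_left hv0 hvtop).1 hvol
  rw [← ENNReal.ofReal_natCast, ← ENNReal.ofReal_mul (Nat.cast_nonneg _),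
    ENNReal.ofReal_le_ofReal_iff (by positivity)] at h2
  -- (card) (ε/2)³ ≤ (R + ε/2)³
  have hε3 : 0 < (ε / 2) ^ 3 := by positivity
  calc (A.card : ℝ) ≤ (R + ε / 2) ^ 3 / (ε / 2) ^ 3 := by rw [le_div_iff₀ hε3]; exact h2
    _ = (2 * R / ε + 1) ^ 3 := by
        rw [← div_pow]
        congr 1
        field_simp

/-! ## The density cap -/

/-- **Hard-core density cap.** On the hard-sphere domain of the torus geometry (mutual minimal-image
distances `≥ ε`), a non-negative kernel bounded by `Cmax` and supported in the minimal-image ball of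
radius `R` about `0` collects at most `Cmax (2R/ε + 1)³` from any configuration, at every `x`. -/
theorem sum_kernel_le {N : ℕ} {ε : ℝ} {z : Cfg N}
    (hz : z ∈ hardSphereDomain (Torus.geometry (Fin 3)) (N + 1) ε) (φ : T3 → ℝ) {Cmax R : ℝ}
    (hφ0 : ∀ y, 0 ≤ φ y) (hφC : ∀ y, φ y ≤ Cmax) (hsupp : ∀ y, R ≤ euclidDist y 0 → φ y = 0)
    (hε : 0 < ε) (hR : 0 ≤ R) (hhalf : R + ε / 2 < 1 / 2) (x : T3) :
    ∑ i, φ ((z i).1 - x) ≤ Cmax * (2 * R / ε + 1) ^ 3 := by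
  have hC0 : 0 ≤ Cmax := (hφ0 0).trans (hφC 0)
  set A := Finset.univ.filter fun i : Fin (N + 1) => euclidDist (z i).1 x < R with hA
  -- outside the ball the kernel vanishes
  have hsplit : ∑ i, φ ((z i).1 - x) = ∑ i ∈ A, φ ((z i).1 - x) := by
    rw [← Finset.sum_filter_add_sum_filter_not Finset.univ (fun i : Fin (N + 1) =>
      euclidDist (z i).1 x < R)]
    have h0 : ∑ i ∈ Finset.univ.filter (fun i : Fin (N + 1) => ¬ euclidDist (z i).1 x < R),
        φ ((z i).1 - x) = 0 := by
      refine Finset.sum_eq_zero fun i hi => ?_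
      have hi' : ¬ euclidDist (z i).1 x < R := (Finset.mem_filter.1 hi).2
      exact hsupp _ (by rw [euclidDist_sub_zero]; exact le_of_not_gt hi')
    rw [h0, add_zero]
  -- inside, count with the packing bound
  have hsep : ∀ i ∈ (Finset.univ : Finset (Fin (N + 1))), ∀ j ∈ (Finset.univ : Finset (Fin (N + 1))),
      i ≠ j → ε ≤ euclidDist (z i).1 (z j).1 := by
    intro i _ j _ hij
    have h := (mem_hardSphereDomain.1 hz) i j hij
    rwa [Torus.geometry_sepVec, ← euclidDist_eq] at h
  have hcard := card_filter_near_le Finset.univ (fun i : Fin (N + 1) => (z i).1) x hε hR hhalf hsep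
  rw [hsplit]
  calc ∑ i ∈ A, φ ((z i).1 - x) ≤ ∑ _i ∈ A, Cmax := Finset.sum_le_sum fun i _ => hφC _
    _ = (A.card : ℝ) * Cmax := by rw [Finset.sum_const, nsmul_eq_mul]
    _ ≤ (2 * R / ε + 1) ^ 3 * Cmax := mul_le_mul_of_nonneg_right hcard hC0
    _ = Cmax * (2 * R / ε + 1) ^ 3 := mul_comm _ _

/-- **The block weights of an admissible kernel family have bounded mass on good configurations**:
`Σ_i w_i(s, x) ≤ C (N+1)^{3γ} (2 (N+1)^{-γ}/ε_N + 1)³` whenever `Φ_s z` lies in the hard-sphere domain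
(which good orbits never leave) and `(N+1)^{-γ} + ε_N/2 < 1/2`. -/
theorem sum_wgt_le {σ : ℝ} {N : ℕ} (Φ : Flow σ N) {γ C : ℝ} {φ : ℕ → T3 → ℝ}
    (hadm : AdmissibleKernel γ C φ) (hε : 0 < Literature.MathematicalPhysics.KineticTheory.hsDiameter σ N)
    (hhalf : ((N : ℝ) + 1) ^ (-γ) + Literature.MathematicalPhysics.KineticTheory.hsDiameter σ N / 2 < 1 / 2)
    (s : ℝ) (z : Cfg N)
    (hz : Φ.flow s z ∈ hardSphereDomain (Torus.geometry (Fin 3)) (N + 1)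
      (Literature.MathematicalPhysics.KineticTheory.hsDiameter σ N)) (x : T3) :
    ∑ i, wgt σ N Φ φ s z x i ≤ C * ((N : ℝ) + 1) ^ (3 * γ) *
      (2 * ((N : ℝ) + 1) ^ (-γ) / Literature.MathematicalPhysics.KineticTheory.hsDiameter σ N + 1) ^ 3 := by
  obtain ⟨-, h0, -, hsupp, hC, -⟩ := hadm
  have hR : 0 ≤ ((N : ℝ) + 1) ^ (-γ) := Real.rpow_nonneg (by positivity) _
  exact sum_kernel_le hz (φ N) (h0 N) (hC N) (hsupp N) hε hR hhalf x

/-- Registered anchor of this helper file (the packing bound `card_filter_near_le` at `ι = Fin n`). -/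
theorem pastDamping_densityCap_anchor : ∀ (n : ℕ) (p : Fin n → T3) (x : T3) (ε R : ℝ), 0 < ε → 0 ≤ R → R + ε / 2 < 1 / 2 → (∀ i j : Fin n, i ≠ j → ε ≤ Literature.Analysis.FluidPDE.Torus.euclidDist (p i) (p j)) → (((Finset.univ.filter fun i : Fin n => Literature.Analysis.FluidPDE.Torus.euclidDist (p i) x < R).card : ℝ) ≤ (2 * R / ε + 1) ^ 3) :=
  fun _ p x _ _ hε hR hhalf hsep =>
    card_filter_near_le Finset.univ p x hε hR hhalf fun i _ j _ hij => hsep i j hij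

end

end PastDamping
end Summit.AtomisticToContinuum.HydrodynamicLimit.Theorems.ContactSourceDuhamel.TimeLocal
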